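import Summits.QuantumFields.BalabanUV.Beta.EriceRemainderEnclosureHistoryAutonomyComparisonAgeCompositionStaticEndEnteringEdge

/-!
# EriceRemainderEnclosureHistoryAutonomyComparisonAgeCompositionStaticEndEnteringEdgeEnd — (E87c) the END of (E87b): route (N), first order, the comparison surplus of every
# admissible excess is non-negative, given the static families with the entering-lag options — the per-pair family being (S-h♭), (S-h) SHARPENED AT THE EDGE

Cell `pub-balaban`, β-function sub-cell, BINDER row D4 (owner lineage `b2b-balaban-beta-an4`; this file by co-owner #2 lineage `b2b-balaban-beta-d4-p2`,
generation 78), FREEZE (0) honoured (def-free; imports (E87b); (E86g)'s END wrapper copied onto the re-cut induction; nothing else restated).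

HONEST FRAMING (page 1, verbatim and binding).  *"Discharging BetaPertH makes Bałaban's UV stability UNCONDITIONAL — a real constructive-QFT result; it is
NOT the continuum limit and NOT the Clay problem."*  THIS FILE DISCHARGES NOTHING OF THE KIND.  Elementary real algebra about ABSTRACT renewal systems —
hypotheses of a census, not facts; nothing of Bałaban's (1.22) limit functional is PRINTED ([I] p. 298) or asserted.  Row D4 class UNCHANGED (critical-path
width 0; instance 0∕1; D4 DISCHARGE NO DATE).  HONEST DEPENDENCY: continuum YM on T⁴ ⇐ BetaPertH ∧ nine spine estimates (0/9 proved).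

THE POINT (census sense (α); route (N); README `HOME/b2b-balaban-beta-d4-p2/g78/e87/README.md`).  **`nonneg_of_static_families_entering_edge`**: the
END on (E87b) `nonneg_and_drop_ratio_all_ages_entering_edge` at the level 1 plus uniqueness of the zero-tailed solution — (E86g)
`nonneg_of_static_families_entering_free` with the fourth per-pair option's family (S-h♭) (truncation indicator `[m+2+y_k+l ≤ j]` on the left; (S-h) as
typed in (E86d)∕(E86f)∕(E86g) is violated on benign benchmark three-age flows for `k₃ ≥ 48` at the edge truncation — census g78 — while (S-h♭) is the robust
family of the generation-77 census).  NOT CLAIMED: any family along flows; anything printed.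
PROVED ([folklore]; 0 `def`, 0 sorry): **`nonneg_of_static_families_entering_edge`**.
-/
noncomputable section
open Finset

namespace Summit.QuantumFields.BalabanUV.Beta.EriceRemainderEnclosureHistoryAutonomyComparisonAgeCompositionStaticEndEnteringEdgeEnd

open Summit.QuantumFields.BalabanUV.Beta.EriceRemainderEnclosureHistoryAutonomyComparisonAgeComposition
open Summit.QuantumFields.BalabanUV.Beta.EriceRemainderEnclosureHistoryAutonomyComparisonAgeCompositionStaticEndEnteringEdge

variable {N n : ℕ} {KL KA : ℕ → ℕ → ℕ → ℝ} {RL RA SL SA : ℕ → (ℕ → ℝ) → ℕ → ℝ} {y : ℕ → ℕ} {θ : ℕ → ℕ → ℕ → ℝ}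

/-- **ROUTE (N), FIRST ORDER, END — ENTERING-LAG OPTIONS WITH (S-h♭).**  As (E86g) `nonneg_of_static_families_entering_free` on (E87b)
`nonneg_and_drop_ratio_all_ages_entering_edge`: `ε ≥ 0` for every admissible excess. [folklore] -/
theorem nonneg_of_static_families_entering_edge
    (hKL : ∀ i m l, 0 ≤ KL i m l) (hKLN : ∀ i m l, N ≤ l → KL i m l = 0) (hKLy : ∀ i m l, y i ≤ l → KL i m l = 0)
    (hRL : ∀ i v m, RL i v m = ∑ l ∈ range N, KL i m l * v (m + 1 + l))
    (hRA : ∀ i v m, RA i v m = ∑ l ∈ range N, KA i m l * v (m + 1 + l))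
    (hKA : ∀ i m l, KA i m l = KL i m l + KA (i + 1) m l) (hKAtop : ∀ m l, KA (n + 1) m l = 0)
    (hSL : ∀ i (w : ℕ → ℝ), (∀ m, N < m → w m = 0) → (∀ m, N < m → SL i w m = 0) ∧ ∀ m, SL i w m = w m - RL i (SL i w) m)
    (hSA : ∀ i (w : ℕ → ℝ), (∀ m, N < m → w m = 0) → (∀ m, N < m → SA i w m = 0) ∧ ∀ m, SA i w m = w m - RA i (SA i w) m)
    (hy : ∀ i, 1 ≤ i → i ≤ n → 1 ≤ y i ∧ y i ≤ N)
    (hθ0 : ∀ k m l, 0 ≤ θ k m l) (hpers : ∀ k m l i', (1 - θ k m l) * KL k m (i' + l) ≤ KL k (m + l) i')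
    (hθmono : ∀ k m l l', l ≤ l' → θ k m l ≤ θ k m l')
    {ρ : ℕ → ℕ → ℝ} {β : ℕ → ℕ → ℕ → ℝ}
    (hρ : ∀ i m, 1 ≤ i → i ≤ n → ρ i m = (∑ l ∈ range N, KL i m l) * (1 + ∑ k ∈ Ioc i n, θ k m (y i) * β (i + 1) m k) /
      (1 - ∑ k ∈ Ioc i n, ∑ l ∈ range (y i), KL k m l))
    (hβnew : ∀ i m, 1 ≤ i → i ≤ n → β i m i = ρ i m / (1 - ρ i m))
    (hβold : ∀ i m k, 1 ≤ i → i < k → k ≤ n → β i m k = β (i + 1) m k / (1 - ρ i m))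
    (hΩ1 : ∀ i m, 1 ≤ i → i ≤ n → ∑ k ∈ Ioc i n, ∑ l ∈ range (y i), KL k m l < 1)
    (hclose : ∀ i m, 1 ≤ i → i ≤ n → ρ i m < 1)
    (hshift : ∀ k m l, l + 1 < y k → KL k (m + 1) l ≤ KL k m (l + 1))
    (hΩ0 : ∀ i m, i ≤ n → ∑ k ∈ Ioc i n, KL k m 0 < 1)
    {Hg : ℕ → ℕ → ℝ} (hH : ∀ i m, Hg i m = (1 + ∑ k ∈ Ioc i n, θ k m 1 * β (i + 1) m k) / (1 - ∑ k ∈ Ioc i n, KL k m 0))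
    {σ : ℕ → ℕ → ℝ} (hσ1 : ∀ k m l, l + 1 < y k → KL k (m + 1) l = σ k m * KL k m (l + 1)) (hσ01 : ∀ k m, 0 ≤ σ k m ∧ σ k m ≤ 1)
    {AL : ℕ → ℕ → ℕ → ℝ} (hAL : ∀ i j p, AL i j p = ∑ l ∈ range (y i), if p + 1 + l ≤ j then KL i p l * (1 - ρ i (p + 1 + l)) else 0)
    {P : ℕ → Prop}
    (hMONOopt : ∀ i k, 1 ≤ i → i < k → k ≤ n →
      (∀ m L, ∑ l ∈ range (L + 1), KL k (m + 1) l ≤ ∑ l ∈ range (L + 2), KL k m l) ∨ (∀ m l, KL i m l = 0) ∨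
      (y i = 1 ∧ ∀ m, KL k (m + 1) (y k - 1) * KL i (m + 1 + y k) 0 * ∏ p ∈ Ico (m + 2) (m + 2 + y k), Hg i p ≤
        KL k m 0 * KL i (m + 1) 0 * (1 - KL i (m + 2) 0 * Hg i (m + 2))) ∨
      (P (i + 1) ∧ ∀ j m, m + 1 + y k ≤ j →
        KL k (m + 1) (y k - 1) * ∑ l ∈ range (y i), (if m + 2 + y k + l ≤ j then KL i (m + 1 + y k) l * ∏ s ∈ Ico (m + 2) (m + 2 + y k + l), Hg i s else 0) ≤
          (1 - σ k m) * ∑ l' ∈ range (y k), KL k m l' * AL i j (m + 1 + l') + σ k m * (KL k m 0 * AL i j (m + 1))))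
    {M : ℕ → ℕ → ℝ} (hM : ∀ i m, M i m = KL i m 0 + ∑ l ∈ range (N - 1), max (KL i m (l + 1) - KL i (m + 1) l) 0)
    {HgS : ℕ → ℕ → ℕ → ℝ} (hHS : ∀ i j m, HgS i j m = (1 + ∑ k ∈ Ioc i n, θ k m 1 * β (i + 1) m k) /
      (1 - ∑ k ∈ Ioc i n, (KL k m 0 - if m + 1 + y k ≤ j then KL k (m + 1) (y k - 1) else 0)))
    (hlev : ∀ i, 1 ≤ i → i < n →
      (y i = 1 ∧ ∀ m, (1 + M i m) * (Hg i (m + 1) * KL i (m + 1) 0) ≤ KL i m 0) ∨ (∀ m l, KL i m l = 0) ∨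
      (P (i + 1) ∧ (∀ m L', L' < y i → (1 + M i m) * ∑ l ∈ Ico L' (y i), Hg i (m + 1 + l) * KL i (m + 1) l ≤ ∑ l ∈ Ico L' (y i), KL i m l) ∧
        (∀ m L, L < y i → ∀ L', L' ≤ L → (1 + M i m) * ∑ l ∈ Ico L' L, Hg i (m + 1 + l) * KL i (m + 1) l ≤ ∑ l ∈ Ico L' (L + 1), KL i m l)) ∨
      (∀ m, KL i (m + 1) (y i - 1) ≤ (1 - σ i m) * ∑ l ∈ range (y i), KL i m l * (1 - ρ i (m + 1 + l)) / ∏ p ∈ Ico (m + 1 + l) (m + 1 + y i), Hg i p +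
        σ i m * (KL i m 0 * (1 - ρ i (m + 1)) / ∏ p ∈ Ico (m + 1) (m + 1 + y i), Hg i p)))
    (hM1opt : ∀ i, 1 ≤ i → i ≤ n → P i →
      ((∀ m j, m + 1 + N ≤ j → ∀ L', L' < N → ∑ l ∈ Ico L' N, HgS (i - 1) j (m + 1 + l) * KA i (m + 1) l ≤ ∑ l ∈ Ico L' N, KA i m l) ∧
       (∀ m L, L < N → ∀ L', L' ≤ L → ∑ l ∈ Ico L' L, HgS (i - 1) (m + 1 + L) (m + 1 + l) * KA i (m + 1) l ≤ ∑ l ∈ Ico L' (L + 1), KA i m l)) ∨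
      (∀ j, j ≤ N → ∀ m, m < j → SA i (fun m => if m ≤ j then (1:ℝ) else 0) m ≤ SA i (fun m => if m ≤ j then (1:ℝ) else 0) (m + 1)))
    {e ε : ℕ → ℝ} (he0 : ∀ m, 0 ≤ e m) (hea : ∀ m, e (m + 1) ≤ e m) (het : ∀ m, N < m → e m = 0)
    (hεt : ∀ m, N < m → ε m = 0) (hεrec : ∀ m, ε m = e m - RA 1 ε m) : ∀ m, 0 ≤ ε m := by
  rcases Nat.eq_zero_or_pos n with hn0 | hn0
  · subst hn0; intro m; rw [hεrec m, hRA, sum_eq_zero fun l _ => by rw [hKAtop, zero_mul]]; linarith [he0 m]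
  have h := (nonneg_and_drop_ratio_all_ages_entering_edge hKL hKLN hKLy hRL hRA hKA hKAtop hSL hSA hy hθ0 hpers hθmono hρ hβnew hβold hΩ1 hclose
    hshift hΩ0 hH hσ1 hσ01 hAL hMONOopt hM hHS hlev hM1opt 1 le_rfl (by omega)).2.1 e he0 hea het
  have heq : ∀ m, ε m = SA 1 e m := sol_unique (hRA 1) hεt hεrec (hSA 1 e het).1 (hSA 1 e het).2
  exact fun m => (heq m).symm ▸ h.1 m

end Summit.QuantumFields.BalabanUV.Beta.EriceRemainderEnclosureHistoryAutonomyComparisonAgeCompositionStaticEndEnteringEdgeEnd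

end
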